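import Summits.NavierStokesRegularity.NavierStokesRegularity.Theorems.SkeletonEquilibrium.Negative.StrainIdentity

/-!
# `SkeletonEquilibrium` (stmt-NavierStokesRegularity-15400): the waist tangent law every witness obeys

Negative-side support for the crux `FilamentSkeletonRss.SkeletonEquilibrium` (leafhand
`leafhand-ns-filamentskeletonrs-4-g0`, 2026-08-31); the first-derivative companion of the landed
`…Negative.StrainIdentity` (`w′ = ½ + ⟪F′, Ξ′⟫`). Differentiate the tangency relation
`F(τ) + V_α(Ξ τ) = w(τ) Ξ′(τ)` (`V_α y = ½ y − α e₃ × y`, `F` = the induced velocity along the filament)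
ONCE at a stagnation point `τ*` (`w(τ*) = 0`): the curvature term `w Ξ″` drops out and the whole vector
identity survives, not only its tangential component:

* `waist_deriv_eq` — `F′(τ*) = (w′(τ*) − ½)·T − (−α e₃ × T) = (w′(τ*) − ½) T + α e₃ × T`, `T = Ξ′(τ*)`:
  at a waist the tangent is an EIGENVECTOR of `D(F + V_α)` with eigenvalue `w′(τ*)`, equivalently the
  along-filament derivative of the induced velocity has tangential part `w′ − ½` (the strain identity) and
  normal part EXACTLY `α e₃ × T` (the frame rotation of the tangent), whatever induces `F`.
* `waist_pythagoras` — hence `‖F′(τ*)‖² = (w′(τ*) − ½)² + α² ‖e₃ × T‖²`.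
* `waist_tilt_le` / `waist_strain_le` — `|α| ‖e₃ × T‖ ≤ ‖F′(τ*)‖` and `|w′(τ*) − ½| ≤ ‖F′(τ*)‖`: the TILT
  of the waist tangent off the rotation axis and the supercritical margin are both paid for by the size of
  the along-filament velocity derivative at the waist; `waist_vertical_of_deriv_tangential` — if that
  derivative is tangential (in particular zero) and `α ≠ 0`, the waist tangent is vertical (`e₃ × T = 0`),
  the pointwise germ of the landed global statement `StraightLinesVertical.straight_lines_vertical`.
* `witness_waist_deriv_eq`, `witness_waist_tilt_le`, `witness_waist_budget` — the same for the crux's own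
  data (per-filament clauses + relative-equilibrium system, any `N, γ, α, Γ`), with `F` the skeleton's
  regularised Biot–Savart velocity along filament `j` (differentiable by `witness_slope_eq`): at every
  stagnation point `(w_j′(τ*) − ½)² + α²‖e₃ × Ξ_j′(τ*)‖² = ‖(u_skel ∘ Ξ_j)′(τ*)‖²`, so a supercritical
  (`w′ ≥ 3/2 + δ`) and `θ`-tilted waist needs `‖(u_skel ∘ Ξ_j)′(τ*)‖² ≥ (1+δ)² + α²θ²`
  (`witness_waist_budget` with `m = 3/2 + δ`).

Use for both sides of K1: the verticality-at-the-waist theme of the negation lines (`kelvin-sonic-negation`: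
tangents near a waist are near-vertical; `mirror-point-selection`: the waist is a mirror point of the outer
Lorentz dynamics) gets an exact pointwise anchor — the waist tilt IS `‖P_⊥(u_skel∘Ξ_j)′(τ*)‖/|α|` — and a
constructive witness must realise normal velocity shear `α e₃ × T` across its waist on top of the axial
strain `≥ 1 + δ`.
-/

set_option linter.dupNamespace false

namespace Summit.NavierStokesRegularity.NavierStokesRegularity.Theorems.SkeletonEquilibrium.Negative

open Literature.Analysis.FluidPDE MeasureTheory
open scoped RealInnerProductSpace InnerProductSpace BigOperators

/-- `⟪a × b, b⟫ = 0` (coordinate identity; local copy, the tree's copies are `private`). [folklore] -/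
private theorem inner_cross_self_right' (a b : EuclideanSpace ℝ (Fin 3)) : ⟪cross a b, b⟫ = 0 := by
  simp only [cross, PiLp.inner_apply, RCLike.inner_apply, conj_trivial, Fin.sum_univ_three,
    cross_apply, Matrix.cons_val_zero, Matrix.cons_val_one, Matrix.cons_val_two,
    Matrix.head_cons, Matrix.tail_cons]
  ring

/-- The drift `V_α(Ξ)` along a differentiable curve has derivative `V_α(Ξ′)` (linearity of
`y ↦ ½ y − α e₃ × y`; local copy of the `private` lemma of `StrainIdentity`). [folklore] -/
private theorem hasDerivAt_drift' {α : ℝ} {Ξ : ℝ → EuclideanSpace ℝ (Fin 3)}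
    {T : EuclideanSpace ℝ (Fin 3)} {τ : ℝ} (hΞ : HasDerivAt Ξ T τ) :
    HasDerivAt (fun σ => (1 / 2 : ℝ) • Ξ σ - α • cross (EuclideanSpace.single (2 : Fin 3) (1 : ℝ)) (Ξ σ))
      ((1 / 2 : ℝ) • T - α • cross (EuclideanSpace.single (2 : Fin 3) (1 : ℝ)) T) τ := by
  have h2 : HasDerivAt (fun σ => cross (EuclideanSpace.single (2 : Fin 3) (1 : ℝ)) (Ξ σ))
      (cross (EuclideanSpace.single (2 : Fin 3) (1 : ℝ)) T) τ := by
    have h := (crossCLM (EuclideanSpace.single (2 : Fin 3) (1 : ℝ))).hasFDerivAt.comp_hasDerivAt τ hΞ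
    simpa [Function.comp_def, crossCLM_apply] using h
  exact (hΞ.const_smul (1 / 2 : ℝ)).sub (h2.const_smul α)

/-- **Waist tangent law (abstract form).** Let `Ξ` be a `C²` curve, `F` differentiable, `w` differentiable,
with the tangency relation `F(τ) + ½ Ξ(τ) − α e₃ × Ξ(τ) = w(τ) Ξ′(τ)`. At a zero `τ*` of `w`,
`F′(τ*) = w′(τ*) Ξ′(τ*) − (½ Ξ′(τ*) − α e₃ × Ξ′(τ*))`. [folklore] -/
theorem waist_deriv_eq {α : ℝ} {Ξ F : ℝ → EuclideanSpace ℝ (Fin 3)} {w : ℝ → ℝ}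
    (hΞ : ContDiff ℝ 2 Ξ) (hF : Differentiable ℝ F) (hw : Differentiable ℝ w)
    (heq : ∀ τ, F τ + ((1 / 2 : ℝ) • Ξ τ - α • cross (EuclideanSpace.single (2 : Fin 3) (1 : ℝ)) (Ξ τ)) =
      w τ • deriv Ξ τ)
    {τs : ℝ} (hz : w τs = 0) :
    deriv F τs = deriv w τs • deriv Ξ τs -
      ((1 / 2 : ℝ) • deriv Ξ τs - α • cross (EuclideanSpace.single (2 : Fin 3) (1 : ℝ)) (deriv Ξ τs)) := by
  have hd : Differentiable ℝ Ξ := hΞ.differentiable (by norm_num)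
  have hd' : Differentiable ℝ (deriv Ξ) := hΞ.differentiable_deriv_two
  -- derivative of the left-hand side
  have hL : HasDerivAt (fun τ => F τ + ((1 / 2 : ℝ) • Ξ τ -
      α • cross (EuclideanSpace.single (2 : Fin 3) (1 : ℝ)) (Ξ τ)))
      (deriv F τs + ((1 / 2 : ℝ) • deriv Ξ τs -
        α • cross (EuclideanSpace.single (2 : Fin 3) (1 : ℝ)) (deriv Ξ τs))) τs :=
    (hF τs).hasDerivAt.add (hasDerivAt_drift' (hd τs).hasDerivAt)
  -- derivative of the right-hand side
  have hR : HasDerivAt (fun τ => w τ • deriv Ξ τ)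
      (w τs • deriv (deriv Ξ) τs + deriv w τs • deriv Ξ τs) τs :=
    (hw τs).hasDerivAt.smul (hd' τs).hasDerivAt
  rw [show (fun τ => F τ + ((1 / 2 : ℝ) • Ξ τ -
      α • cross (EuclideanSpace.single (2 : Fin 3) (1 : ℝ)) (Ξ τ))) = fun τ => w τ • deriv Ξ τ from
    funext heq] at hL
  have h := hL.unique hR
  rw [hz, zero_smul, zero_add] at h
  rw [← h, add_sub_cancel_right]

/-- **Waist Pythagoras.** Under the hypotheses of `waist_deriv_eq` with `‖Ξ′‖ ≡ 1`:
`‖F′(τ*)‖² = (w′(τ*) − ½)² + α² ‖e₃ × Ξ′(τ*)‖²` (the tangential part `(w′ − ½)T` and the normal part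
`α e₃ × T` are orthogonal). [folklore] -/
theorem waist_pythagoras {α : ℝ} {Ξ F : ℝ → EuclideanSpace ℝ (Fin 3)} {w : ℝ → ℝ}
    (hΞ : ContDiff ℝ 2 Ξ) (hunit : ∀ τ, ‖deriv Ξ τ‖ = 1) (hF : Differentiable ℝ F)
    (hw : Differentiable ℝ w)
    (heq : ∀ τ, F τ + ((1 / 2 : ℝ) • Ξ τ - α • cross (EuclideanSpace.single (2 : Fin 3) (1 : ℝ)) (Ξ τ)) =
      w τ • deriv Ξ τ)
    {τs : ℝ} (hz : w τs = 0) :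
    ‖deriv F τs‖ ^ 2 = (deriv w τs - 1 / 2) ^ 2 +
      α ^ 2 * ‖cross (EuclideanSpace.single (2 : Fin 3) (1 : ℝ)) (deriv Ξ τs)‖ ^ 2 := by
  have h := waist_deriv_eq hΞ hF hw heq hz
  set T := deriv Ξ τs with hT
  set N := cross (EuclideanSpace.single (2 : Fin 3) (1 : ℝ)) T with hN
  have hdec : deriv F τs = (deriv w τs - 1 / 2) • T + α • N := by
    rw [h, hN]; module
  have hTT : ⟪T, T⟫ = 1 := by rw [real_inner_self_eq_norm_sq, hT, hunit τs, one_pow]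
  have hNT : ⟪N, T⟫ = 0 := inner_cross_self_right' _ _
  have hTN : ⟪T, N⟫ = 0 := by rw [real_inner_comm]; exact hNT
  rw [← real_inner_self_eq_norm_sq, hdec, inner_add_left, inner_add_right, inner_add_right,
    real_inner_smul_left, real_inner_smul_left, real_inner_smul_right, real_inner_smul_right,
    real_inner_smul_left, real_inner_smul_right, real_inner_smul_left, real_inner_smul_right,
    hTT, hNT, hTN, real_inner_self_eq_norm_sq]
  ring

/-- **Waist tilt bound.** `|α| · ‖e₃ × Ξ′(τ*)‖ ≤ ‖F′(τ*)‖`: the tilt of the waist tangent off the rotation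
axis is paid for by the along-filament derivative of the induced velocity. [folklore] -/
theorem waist_tilt_le {α : ℝ} {Ξ F : ℝ → EuclideanSpace ℝ (Fin 3)} {w : ℝ → ℝ}
    (hΞ : ContDiff ℝ 2 Ξ) (hunit : ∀ τ, ‖deriv Ξ τ‖ = 1) (hF : Differentiable ℝ F)
    (hw : Differentiable ℝ w)
    (heq : ∀ τ, F τ + ((1 / 2 : ℝ) • Ξ τ - α • cross (EuclideanSpace.single (2 : Fin 3) (1 : ℝ)) (Ξ τ)) =
      w τ • deriv Ξ τ)
    {τs : ℝ} (hz : w τs = 0) :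
    |α| * ‖cross (EuclideanSpace.single (2 : Fin 3) (1 : ℝ)) (deriv Ξ τs)‖ ≤ ‖deriv F τs‖ := by
  have h := waist_pythagoras hΞ hunit hF hw heq hz
  have h1 : (|α| * ‖cross (EuclideanSpace.single (2 : Fin 3) (1 : ℝ)) (deriv Ξ τs)‖) ^ 2 ≤
      ‖deriv F τs‖ ^ 2 := by
    rw [mul_pow, sq_abs, h]
    nlinarith [sq_nonneg (deriv w τs - 1 / 2)]
  exact (sq_le_sq₀ (mul_nonneg (abs_nonneg _) (norm_nonneg _)) (norm_nonneg _)).1 h1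

/-- **Waist strain bound.** `|w′(τ*) − ½| ≤ ‖F′(τ*)‖` (norm form of the strain identity at a waist).
[folklore] -/
theorem waist_strain_le {α : ℝ} {Ξ F : ℝ → EuclideanSpace ℝ (Fin 3)} {w : ℝ → ℝ}
    (hΞ : ContDiff ℝ 2 Ξ) (hunit : ∀ τ, ‖deriv Ξ τ‖ = 1) (hF : Differentiable ℝ F)
    (hw : Differentiable ℝ w)
    (heq : ∀ τ, F τ + ((1 / 2 : ℝ) • Ξ τ - α • cross (EuclideanSpace.single (2 : Fin 3) (1 : ℝ)) (Ξ τ)) =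
      w τ • deriv Ξ τ)
    {τs : ℝ} (hz : w τs = 0) :
    |deriv w τs - 1 / 2| ≤ ‖deriv F τs‖ := by
  have h := waist_pythagoras hΞ hunit hF hw heq hz
  have h1 : |deriv w τs - 1 / 2| ^ 2 ≤ ‖deriv F τs‖ ^ 2 := by
    rw [sq_abs, h]
    nlinarith [sq_nonneg α, sq_nonneg ‖cross (EuclideanSpace.single (2 : Fin 3) (1 : ℝ)) (deriv Ξ τs)‖,
      mul_nonneg (sq_nonneg α)
        (sq_nonneg ‖cross (EuclideanSpace.single (2 : Fin 3) (1 : ℝ)) (deriv Ξ τs)‖)]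
  exact (sq_le_sq₀ (abs_nonneg _) (norm_nonneg _)).1 h1

/-- **Tangential velocity derivative forces a vertical waist.** If `α ≠ 0` and the along-filament
derivative of the induced velocity at the waist is tangential, `F′(τ*) = c Ξ′(τ*)` (in particular if it
vanishes), then `e₃ × Ξ′(τ*) = 0`: the waist tangent is vertical. [folklore] -/
theorem waist_vertical_of_deriv_tangential {α : ℝ} {Ξ F : ℝ → EuclideanSpace ℝ (Fin 3)} {w : ℝ → ℝ}
    (hΞ : ContDiff ℝ 2 Ξ) (hunit : ∀ τ, ‖deriv Ξ τ‖ = 1) (hF : Differentiable ℝ F)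
    (hw : Differentiable ℝ w)
    (heq : ∀ τ, F τ + ((1 / 2 : ℝ) • Ξ τ - α • cross (EuclideanSpace.single (2 : Fin 3) (1 : ℝ)) (Ξ τ)) =
      w τ • deriv Ξ τ)
    (hα : α ≠ 0) {τs : ℝ} (hz : w τs = 0) {c : ℝ} (hc : deriv F τs = c • deriv Ξ τs) :
    cross (EuclideanSpace.single (2 : Fin 3) (1 : ℝ)) (deriv Ξ τs) = 0 := by
  have h := waist_deriv_eq hΞ hF hw heq hz
  set T := deriv Ξ τs with hT
  set N := cross (EuclideanSpace.single (2 : Fin 3) (1 : ℝ)) T with hN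
  -- `α N = (c − w′ + ½) T`, and `N ⊥ T` with `‖T‖ = 1`
  have hdec : α • N = (c - deriv w τs + 1 / 2) • T := by
    have : c • T = deriv w τs • T - ((1 / 2 : ℝ) • T - α • N) := by rw [← hc, h]
    rw [show α • N = c • T - (deriv w τs - 1 / 2) • T by rw [this]; module]
    module
  have hNT : ⟪N, T⟫ = 0 := inner_cross_self_right' _ _
  have hTT : ⟪T, T⟫ = 1 := by rw [real_inner_self_eq_norm_sq, hT, hunit τs, one_pow]
  have hcoef : c - deriv w τs + 1 / 2 = 0 := by
    have := congrArg (fun v => ⟪v, T⟫) hdec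
    simp only [real_inner_smul_left, hNT, hTT, mul_zero, mul_one] at this
    linarith
  rw [hcoef, zero_smul, smul_eq_zero] at hdec
  exact hdec.resolve_left hα

/-! ## The crux's own data -/

/-- **Every witness of the crux obeys the waist tangent law.** From the per-filament clauses (C², unit
speed, `w_j` differentiable) and the relative-equilibrium system of `SkeletonEquilibrium` (any
`N, γ, α, Γ`): at every stagnation point `w_j(τ*) = 0`, the along-filament derivative of the skeleton's
regularised Biot–Savart velocity is `(w_j′(τ*) − ½) Ξ_j′(τ*) + α e₃ × Ξ_j′(τ*)` — written here as
`w_j′(τ*) Ξ_j′(τ*) − (½ Ξ_j′(τ*) − α e₃ × Ξ_j′(τ*))`. [folklore] -/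
theorem witness_waist_deriv_eq {N : ℕ} {γ : Fin N → ℝ} {α Γ : ℝ}
    {Ξ : Fin N → ℝ → EuclideanSpace ℝ (Fin 3)} {w : Fin N → ℝ → ℝ}
    (hC2 : ∀ j, ContDiff ℝ 2 (Ξ j)) (hunit : ∀ j τ, ‖deriv (Ξ j) τ‖ = 1)
    (hw : ∀ j, Differentiable ℝ (w j))
    (heq : ∀ j τ, (∑ k : Fin N, (Γ * γ k / (4 * Real.pi)) • ∫ σ : ℝ,
      ((‖Ξ j τ - Ξ k σ‖ ^ 2 + 1) ^ (3 / 2 : ℝ))⁻¹ • cross (deriv (Ξ k) σ) (Ξ j τ - Ξ k σ)) +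
      (1 / 2 : ℝ) • Ξ j τ - α • cross (EuclideanSpace.single (2 : Fin 3) (1 : ℝ)) (Ξ j τ) =
      w j τ • deriv (Ξ j) τ)
    {j : Fin N} {τs : ℝ} (hz : w j τs = 0) :
    deriv (fun τ => ∑ k : Fin N, (Γ * γ k / (4 * Real.pi)) • ∫ σ : ℝ,
      ((‖Ξ j τ - Ξ k σ‖ ^ 2 + 1) ^ (3 / 2 : ℝ))⁻¹ • cross (deriv (Ξ k) σ) (Ξ j τ - Ξ k σ)) τs =
      deriv (w j) τs • deriv (Ξ j) τs -
        ((1 / 2 : ℝ) • deriv (Ξ j) τs -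
          α • cross (EuclideanSpace.single (2 : Fin 3) (1 : ℝ)) (deriv (Ξ j) τs)) := by
  obtain ⟨hFd, -⟩ := witness_slope_eq hC2 hunit hw heq j
  have heq' : ∀ τ, (fun τ => ∑ k : Fin N, (Γ * γ k / (4 * Real.pi)) • ∫ σ : ℝ,
      ((‖Ξ j τ - Ξ k σ‖ ^ 2 + 1) ^ (3 / 2 : ℝ))⁻¹ • cross (deriv (Ξ k) σ) (Ξ j τ - Ξ k σ)) τ +
      ((1 / 2 : ℝ) • Ξ j τ - α • cross (EuclideanSpace.single (2 : Fin 3) (1 : ℝ)) (Ξ j τ)) =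
      w j τ • deriv (Ξ j) τ := fun τ => by rw [← heq j τ, add_sub_assoc]
  exact waist_deriv_eq (hC2 j) hFd (hw j) heq' hz

/-- **Waist budget of a witness.** Same data: at every stagnation point
`(w_j′(τ*) − ½)² + α² ‖e₃ × Ξ_j′(τ*)‖² = ‖(u_skel ∘ Ξ_j)′(τ*)‖²`; so a waist with stretching at least
`m ≥ ½` (`m ≤ w_j′(τ*)`; the crux: `m = 3/2 + δ`) AND tilt at least `θ ≤ ‖e₃ × Ξ_j′(τ*)‖` forces
`(m − ½)² + α² θ² ≤ ‖(u_skel ∘ Ξ_j)′(τ*)‖²`. [folklore] -/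
theorem witness_waist_budget {N : ℕ} {γ : Fin N → ℝ} {α Γ m θ : ℝ}
    {Ξ : Fin N → ℝ → EuclideanSpace ℝ (Fin 3)} {w : Fin N → ℝ → ℝ}
    (hC2 : ∀ j, ContDiff ℝ 2 (Ξ j)) (hunit : ∀ j τ, ‖deriv (Ξ j) τ‖ = 1)
    (hw : ∀ j, Differentiable ℝ (w j))
    (heq : ∀ j τ, (∑ k : Fin N, (Γ * γ k / (4 * Real.pi)) • ∫ σ : ℝ,
      ((‖Ξ j τ - Ξ k σ‖ ^ 2 + 1) ^ (3 / 2 : ℝ))⁻¹ • cross (deriv (Ξ k) σ) (Ξ j τ - Ξ k σ)) +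
      (1 / 2 : ℝ) • Ξ j τ - α • cross (EuclideanSpace.single (2 : Fin 3) (1 : ℝ)) (Ξ j τ) =
      w j τ • deriv (Ξ j) τ)
    {j : Fin N} {τs : ℝ} (hz : w j τs = 0) (hm : 1 / 2 ≤ m) (hsc : m ≤ deriv (w j) τs)
    (hθ : 0 ≤ θ) (htilt : θ ≤ ‖cross (EuclideanSpace.single (2 : Fin 3) (1 : ℝ)) (deriv (Ξ j) τs)‖) :
    (m - 1 / 2) ^ 2 + α ^ 2 * θ ^ 2 ≤
      ‖deriv (fun τ => ∑ k : Fin N, (Γ * γ k / (4 * Real.pi)) • ∫ σ : ℝ,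
        ((‖Ξ j τ - Ξ k σ‖ ^ 2 + 1) ^ (3 / 2 : ℝ))⁻¹ • cross (deriv (Ξ k) σ) (Ξ j τ - Ξ k σ)) τs‖ ^ 2 := by
  obtain ⟨hFd, -⟩ := witness_slope_eq hC2 hunit hw heq j
  have heq' : ∀ τ, (fun τ => ∑ k : Fin N, (Γ * γ k / (4 * Real.pi)) • ∫ σ : ℝ,
      ((‖Ξ j τ - Ξ k σ‖ ^ 2 + 1) ^ (3 / 2 : ℝ))⁻¹ • cross (deriv (Ξ k) σ) (Ξ j τ - Ξ k σ)) τ +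
      ((1 / 2 : ℝ) • Ξ j τ - α • cross (EuclideanSpace.single (2 : Fin 3) (1 : ℝ)) (Ξ j τ)) =
      w j τ • deriv (Ξ j) τ := fun τ => by rw [← heq j τ, add_sub_assoc]
  rw [waist_pythagoras (hC2 j) (hunit j) hFd (hw j) heq' hz]
  have h1 : (m - 1 / 2) ^ 2 ≤ (deriv (w j) τs - 1 / 2) ^ 2 :=
    pow_le_pow_left₀ (by linarith) (by linarith) 2
  have h2 : θ ^ 2 ≤ ‖cross (EuclideanSpace.single (2 : Fin 3) (1 : ℝ)) (deriv (Ξ j) τs)‖ ^ 2 :=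
    pow_le_pow_left₀ hθ htilt 2
  nlinarith [sq_nonneg α, mul_le_mul_of_nonneg_left h2 (sq_nonneg α)]

/-- **Waist tilt of a witness.** Same data: `|α| ‖e₃ × Ξ_j′(τ*)‖ ≤ ‖(u_skel ∘ Ξ_j)′(τ*)‖` at every
stagnation point — near-verticality of the waist tangent is EQUIVALENT to smallness of the normal part of
the along-filament velocity derivative there. [folklore] -/
theorem witness_waist_tilt_le {N : ℕ} {γ : Fin N → ℝ} {α Γ : ℝ}
    {Ξ : Fin N → ℝ → EuclideanSpace ℝ (Fin 3)} {w : Fin N → ℝ → ℝ}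
    (hC2 : ∀ j, ContDiff ℝ 2 (Ξ j)) (hunit : ∀ j τ, ‖deriv (Ξ j) τ‖ = 1)
    (hw : ∀ j, Differentiable ℝ (w j))
    (heq : ∀ j τ, (∑ k : Fin N, (Γ * γ k / (4 * Real.pi)) • ∫ σ : ℝ,
      ((‖Ξ j τ - Ξ k σ‖ ^ 2 + 1) ^ (3 / 2 : ℝ))⁻¹ • cross (deriv (Ξ k) σ) (Ξ j τ - Ξ k σ)) +
      (1 / 2 : ℝ) • Ξ j τ - α • cross (EuclideanSpace.single (2 : Fin 3) (1 : ℝ)) (Ξ j τ) =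
      w j τ • deriv (Ξ j) τ)
    {j : Fin N} {τs : ℝ} (hz : w j τs = 0) :
    |α| * ‖cross (EuclideanSpace.single (2 : Fin 3) (1 : ℝ)) (deriv (Ξ j) τs)‖ ≤
      ‖deriv (fun τ => ∑ k : Fin N, (Γ * γ k / (4 * Real.pi)) • ∫ σ : ℝ,
        ((‖Ξ j τ - Ξ k σ‖ ^ 2 + 1) ^ (3 / 2 : ℝ))⁻¹ • cross (deriv (Ξ k) σ) (Ξ j τ - Ξ k σ)) τs‖ := by
  obtain ⟨hFd, -⟩ := witness_slope_eq hC2 hunit hw heq j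
  have heq' : ∀ τ, (fun τ => ∑ k : Fin N, (Γ * γ k / (4 * Real.pi)) • ∫ σ : ℝ,
      ((‖Ξ j τ - Ξ k σ‖ ^ 2 + 1) ^ (3 / 2 : ℝ))⁻¹ • cross (deriv (Ξ k) σ) (Ξ j τ - Ξ k σ)) τ +
      ((1 / 2 : ℝ) • Ξ j τ - α • cross (EuclideanSpace.single (2 : Fin 3) (1 : ℝ)) (Ξ j τ)) =
      w j τ • deriv (Ξ j) τ := fun τ => by rw [← heq j τ, add_sub_assoc]
  exact waist_tilt_le (hC2 j) (hunit j) hFd (hw j) heq' hz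

end Summit.NavierStokesRegularity.NavierStokesRegularity.Theorems.SkeletonEquilibrium.Negative
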